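import Mathlib
import Summits.Schanuel.Schanuel.Theses.SurplusLinkage
import Literature.NumberTheory.Transcendental.RankOneGridTrdeg

/-!
# Crux `SurplusNonneg` (stmt-Schanuel-18994) — load-bearing hypothesis, tightness, and the
"one side is full" strengthening (negative lane)

Negative-lane support landed by the crux-attack refuter at birth (route `SurplusLinkage`,
`--supports stmt-Schanuel-18994`).  The crux reads: for `ℚ`-linearly independent
`z : Fin n → ℂ`, `n ≤ a + b` with `a = trdeg_ℚ ℚ(z)` and `b = trdeg_ℚ ℚ(e^z)`.  It is a
consequence of Schanuel's conjecture (`c = trdeg ℚ(z, e^z) ≤ a + b`, subadditivity — the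
three-line derivation `Schanuel → SurplusNonneg` is attached to the item as evidence, not declared
here, since a positive route-item conclusion is a prover's landing), so it is irrefutable short of
`¬ Schanuel`; this file records, kernel-checked, what the cheap attacks DO settle:

* `surplusNonneg_false_without_linearIndependent` — the hypothesis `LinearIndependent ℚ z` is
  load-bearing: at `n = 1`, `z = 0` both sides are `ℚ` (`a = b = 0 < 1`).
* `not_surplusNonneg_succ` — the constant is sharp already at `n = 1`: `z = 1` has `a = 0`,
  `b = trdeg ℚ(e) ≤ 1`, so `n` cannot be replaced by `n + 1` (no transcendence input needed).
* `not_surplusNonneg_oneSideFull` — the SUM is essential: the strengthening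
  "`n ≤ a` or `n ≤ b`" (one of the two faces alone is full) fails at the mixed tuple `(1, πi)`,
  where `a = trdeg ℚ(πi) ≤ 1` and `b = trdeg ℚ(e, -1) ≤ 1` (again with no transcendence input);
  so the crux is not the disjunction of its `a = 0` face (Lindemann–Weierstrass) and its `b = 0`
  face (algebraic independence of logarithms) — genuinely mixed tuples exist from `n = 2` on.

## References

* S. Lang, *Introduction to transcendental numbers* (1966), pp. 30–31 (Schanuel's conjecture).
* M. Waldschmidt, in Nesterenko–Philippon (eds.), LNM 1752 (2001), Ch. 14 §2 (the `a = 1`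
  Gel'fond ladder inside the crux).
-/

noncomputable section

set_option linter.dupNamespace false

open Complex Set IntermediateField Cardinal
open Literature.NumberTheory.Transcendental (trdeg_adjoin_union_le trdeg_adjoin_le_mk)

namespace Summit.Schanuel.Schanuel.Theorems.SurplusNonneg.Negative

/-! ### Small tools -/

/-- A field generated over `ℚ` by algebraic numbers has transcendence degree `0`. [folklore] -/
theorem trdeg_adjoin_eq_zero_of_isAlgebraic {S : Set ℂ} (hS : ∀ x ∈ S, IsAlgebraic ℚ x) :
    Algebra.trdeg ℚ ↥(adjoin ℚ S) = 0 := by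
  haveI : Algebra.IsAlgebraic ℚ ↥(adjoin ℚ S) :=
    isAlgebraic_adjoin (fun x hx => (hS x hx).isIntegral)
  exact trdeg_eq_zero

/-- One generator on top of algebraic ones gives transcendence degree `≤ 1`. [folklore] -/
theorem trdeg_adjoin_union_singleton_le_one {S : Set ℂ} (hS : ∀ x ∈ S, IsAlgebraic ℚ x) (w : ℂ) :
    Algebra.trdeg ℚ ↥(adjoin ℚ (S ∪ {w})) ≤ 1 :=
  calc Algebra.trdeg ℚ ↥(adjoin ℚ (S ∪ {w}))
      ≤ Algebra.trdeg ℚ ↥(adjoin ℚ S) + Algebra.trdeg ℚ ↥(adjoin ℚ {w}) := trdeg_adjoin_union_le _ _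
    _ ≤ 0 + 1 := add_le_add (le_of_eq (trdeg_adjoin_eq_zero_of_isAlgebraic hS))
        ((trdeg_adjoin_le_mk _).trans (by simp))
    _ = 1 := zero_add 1

/-- `1, πi` are `ℚ`-linearly independent (real part / imaginary part). [folklore] -/
theorem linearIndependent_one_piI : LinearIndependent ℚ ![(1 : ℂ), Real.pi * Complex.I] := by
  refine LinearIndependent.pair_iff.mpr fun s t hst => ?_
  simp only [Rat.smul_def, mul_one] at hst
  have him := congrArg Complex.im hst
  have hre := congrArg Complex.re hst
  simp only [Complex.add_im, Complex.ratCast_im, Complex.mul_im, Complex.ratCast_re,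
    Complex.ofReal_im, Complex.I_im, Complex.ofReal_re, Complex.I_re, Complex.mul_re,
    Complex.zero_im, mul_zero, sub_zero, mul_one, zero_add, add_zero, Complex.add_re,
    Complex.zero_re] at him hre
  have ht : t = 0 := by
    rcases mul_eq_zero.mp him with h | h
    · exact_mod_cast h
    · exact absurd h Real.pi_ne_zero
  subst ht
  simp at hre
  exact ⟨hre, rfl⟩

/-! ### The linear-independence hypothesis is load-bearing -/

/-- **`SurplusNonneg` is false without `LinearIndependent ℚ z`**: the crux with its only
hypothesis dropped fails at `n = 1`, `z = 0`, where `ℚ(z) = ℚ(e^z) = ℚ` and `a + b = 0 < 1`.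
Any proof must use the hypothesis. [folklore] -/
theorem surplusNonneg_false_without_linearIndependent :
    ¬ (∀ (n : ℕ) (z : Fin n → ℂ), (n : Cardinal) ≤
        Algebra.trdeg ℚ ↥(IntermediateField.adjoin ℚ (Set.range z)) +
          Algebra.trdeg ℚ ↥(IntermediateField.adjoin ℚ (Set.range (Complex.exp ∘ z)))) := by
  intro h
  have h1 := h 1 (fun _ => 0)
  have ha : Algebra.trdeg ℚ ↥(adjoin ℚ (Set.range (fun _ : Fin 1 => (0 : ℂ)))) = 0 :=
    trdeg_adjoin_eq_zero_of_isAlgebraic (by rintro x ⟨i, rfl⟩; exact isAlgebraic_zero)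
  have hb : Algebra.trdeg ℚ ↥(adjoin ℚ (Set.range (Complex.exp ∘ (fun _ : Fin 1 => (0 : ℂ))))) = 0 :=
    trdeg_adjoin_eq_zero_of_isAlgebraic (by rintro x ⟨i, rfl⟩; simp [isAlgebraic_one])
  rw [ha, hb] at h1
  simp at h1

/-! ### Tightness: `n` cannot be replaced by `n + 1` -/

/-- **The constant of `SurplusNonneg` is sharp**: the strengthening `n + 1 ≤ a + b` fails at
`n = 1`, `z = 1` (`a = trdeg ℚ(1) = 0`, `b = trdeg ℚ(e) ≤ 1`).  No transcendence input is used.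
[folklore] -/
theorem not_surplusNonneg_succ :
    ¬ (∀ (n : ℕ) (z : Fin n → ℂ), LinearIndependent ℚ z → ((n + 1 : ℕ) : Cardinal) ≤
        Algebra.trdeg ℚ ↥(IntermediateField.adjoin ℚ (Set.range z)) +
          Algebra.trdeg ℚ ↥(IntermediateField.adjoin ℚ (Set.range (Complex.exp ∘ z)))) := by
  intro h
  have hli : LinearIndependent ℚ (fun _ : Fin 1 => (1 : ℂ)) :=
    linearIndependent_unique_iff.mpr one_ne_zero
  have h1 := h 1 (fun _ => 1) hli
  have ha : Algebra.trdeg ℚ ↥(adjoin ℚ (Set.range (fun _ : Fin 1 => (1 : ℂ)))) = 0 :=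
    trdeg_adjoin_eq_zero_of_isAlgebraic (by rintro x ⟨i, rfl⟩; exact isAlgebraic_one)
  have hb : Algebra.trdeg ℚ ↥(adjoin ℚ (Set.range (Complex.exp ∘ (fun _ : Fin 1 => (1 : ℂ))))) ≤ 1 :=
    (trdeg_adjoin_le_mk _).trans (Cardinal.mk_range_le.trans (by simp))
  rw [ha, zero_add] at h1
  have : ((2 : ℕ) : Cardinal) ≤ 1 := h1.trans hb
  norm_num at this

/-! ### The sum is essential: neither face alone -/

/-- **"One side is full" is false**: the strengthening `n ≤ a ∨ n ≤ b` of `SurplusNonneg` fails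
at the `ℚ`-linearly independent mixed tuple `z = (1, πi)`: `ℚ(z) = ℚ(πi)` and
`ℚ(e^z) = ℚ(e, -1)` both have transcendence degree `≤ 1 < 2`.  Hence the crux is not covered by
its two pure faces (`a = 0`: Lindemann–Weierstrass; `b = 0`: algebraic independence of
logarithms); mixed tuples are genuine from `n = 2` on.  No transcendence input is used. [folklore] -/
theorem not_surplusNonneg_oneSideFull :
    ¬ (∀ (n : ℕ) (z : Fin n → ℂ), LinearIndependent ℚ z →
        (n : Cardinal) ≤ Algebra.trdeg ℚ ↥(IntermediateField.adjoin ℚ (Set.range z)) ∨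
        (n : Cardinal) ≤ Algebra.trdeg ℚ ↥(IntermediateField.adjoin ℚ (Set.range (Complex.exp ∘ z)))) := by
  intro h
  have hr : Set.range ![(1 : ℂ), Real.pi * Complex.I] = {(1 : ℂ)} ∪ {(Real.pi : ℂ) * Complex.I} := by
    ext x; simp
  have hre : Set.range (Complex.exp ∘ ![(1 : ℂ), Real.pi * Complex.I]) = {(-1 : ℂ)} ∪ {cexp 1} := by
    ext x
    simp only [Set.mem_range, Function.comp_apply, Fin.exists_fin_two, Matrix.cons_val_zero,
      Matrix.cons_val_one, Complex.exp_pi_mul_I, Set.singleton_union,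
      Set.mem_insert_iff, Set.mem_singleton_iff]
    tauto
  have ha : Algebra.trdeg ℚ ↥(adjoin ℚ (Set.range ![(1 : ℂ), Real.pi * Complex.I])) ≤ 1 := by
    rw [hr]
    exact trdeg_adjoin_union_singleton_le_one (by simp [isAlgebraic_one]) _
  have hb : Algebra.trdeg ℚ ↥(adjoin ℚ (Set.range (Complex.exp ∘ ![(1 : ℂ), Real.pi * Complex.I]))) ≤ 1 := by
    rw [hre]
    exact trdeg_adjoin_union_singleton_le_one (by simp [isAlgebraic_one.neg]) _
  rcases h 2 _ linearIndependent_one_piI with h2 | h2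
  · have : ((2 : ℕ) : Cardinal) ≤ 1 := h2.trans ha
    norm_num at this
  · have : ((2 : ℕ) : Cardinal) ≤ 1 := h2.trans hb
    norm_num at this

end Summit.Schanuel.Schanuel.Theorems.SurplusNonneg.Negative
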